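import Summits.CriticalPhenomena.PercolationContinuityZ3.Theorems.PercNearOneGluingNoHeavyLowerTailKnQuestion8CoefficientwiseCoreClassKernelMixCycleArcs
import Summits.CriticalPhenomena.PercolationContinuityZ3.Theorems.PercNearOneGluingNoHeavyLowerTailKnQuestion8CoefficientwiseCoreClassKernelMixTwoArcGlue
import HarnessLib

/-!
# THEOREM IET-CYCLE: the increasing-event transfer on a cycle, for every up-set

Support file (`--supports stmt-CriticalPhenomena-4575`, closed), prover `prim-cplus-coupling` (gen 39).  No definitions, no notations, no named facts,
no sorries; standard axioms.  Memo `prim-cplus-coupling/A5-COUPLING-gen39.md` §3.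

CONJECTURE IET (gen 37): for a graph `E`, root `u`, observer `b`, EVERY up-closed event `𝒱` and all monotone levels `0 ≤ hᵃ, hᵇ ≤ h`, `0 ≤ kᵃ, kᵇ ≤ k`,
`Σ_{ω ∈ 𝒱 : b ∈ X∖Y} h(X)k(X) + Σ_{ω ∈ 𝒱 : b ∈ Y∖X} (hᵃX − hᵇY)(kᵃX − kᵇY) ≥ 0` (`X = C_u ω`, `Y = C_u(E∖ω)`).  This file proves it for every CYCLE
through `u` and `b`, given explicitly as two arcs `A₁ = {e₁ 1, …, e₁ L₁}`, `A₂ = {e₂ 1, …, e₂ L₂}` with vertex sequences `w₁, w₂` from `u` to `b` meeting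
only at `u` and `b`:
* `Coefficientwise.cycle_twoRoutes` — (R) `b ∈ C_u(ω) ↔ A₁ ⊆ ω ∨ A₂ ⊆ ω` for `ω ⊆ A₁ ∪ A₂`;
* `Coefficientwise.iet_cycle` — **THEOREM IET-CYCLE**, assembled by `iet_twoArc_of_clusterFacts` (`…KernelMixTwoArcGlue`) from (R) and the arc facts
  (G⋆), (YJ), (Yσ) of `…KernelMixCycleArcs`, i.e. from the FIBRE INJECTION LEMMA, the FIBRE UP-SET LEMMA and the partial swap `σ`.
Gen 37 had the cycle case only for `𝒱 = ⊤` (the gen-31 transfer) and along a FORCED arc (path-contact transfer); gen 37's CONJECTURE PF′ is false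
(memo §1) — the proof here uses the full partner set of a fibre when both arcs carry demand and the all-red point when only one does (memo §3).
[cite: KozmaNitzan2024, Questions 8–9 (§5.5 p. 36) (context: the Question-8 pocket covariance programme)]
-/

namespace Summit.CriticalPhenomena.PercolationContinuityZ3.Theorems

open Finset Literature.Probability.Percolation

namespace Coefficientwise

variable {ι V : Type*}

open Classical in
/-- **(R) The two routes of a cycle.**  For two explicit arcs `A₁, A₂` from `u` to `b` whose vertex sequences meet only at the ends
(`w₁ i = w₂ j ⇒ (i,j) ∈ {(0,0), (L₁,L₂)}`), and `ω ⊆ A₁ ∪ A₂`: `b ∈ C_u(ω) ↔ A₁ ⊆ ω ∨ A₂ ⊆ ω`.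
[cite: KozmaNitzan2024, §5.5 (context only; folklore)] -/
theorem cycle_twoRoutes (ends : ι → Sym2 V) (L₁ L₂ : ℕ) (w₁ w₂ : ℕ → V) (e₁ e₂ : ℕ → ι) (u b : V)
    (hw₁0 : w₁ 0 = u) (hw₁L : w₁ L₁ = b) (hw₂0 : w₂ 0 = u) (hw₂L : w₂ L₂ = b)
    (harc₁ : ∀ t, 1 ≤ t → t ≤ L₁ → ends (e₁ t) = s(w₁ (t - 1), w₁ t))
    (harc₂ : ∀ t, 1 ≤ t → t ≤ L₂ → ends (e₂ t) = s(w₂ (t - 1), w₂ t))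
    (hwinj₁ : ∀ i j, i ≤ L₁ → j ≤ L₁ → w₁ i = w₁ j → i = j)
    (hwinj₂ : ∀ i j, i ≤ L₂ → j ≤ L₂ → w₂ i = w₂ j → i = j)
    (hcross : ∀ i j, i ≤ L₁ → j ≤ L₂ → w₁ i = w₂ j → (i = 0 ∧ j = 0) ∨ (i = L₁ ∧ j = L₂))
    (A₁ A₂ : Finset ι) (hA₁ : ∀ i, i ∈ A₁ ↔ ∃ t, 1 ≤ t ∧ t ≤ L₁ ∧ e₁ t = i) (hA₂ : ∀ i, i ∈ A₂ ↔ ∃ t, 1 ≤ t ∧ t ≤ L₂ ∧ e₂ t = i)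
    (ω : Finset ι) (hω : ω ⊆ A₁ ∪ A₂) :
    b ∈ openCluster (ends '' (↑ω : Set ι)) u ↔ (A₁ ⊆ ω ∨ A₂ ⊆ ω) := by
  constructor
  · intro hb
    by_contra hno
    have hno1 : ¬ A₁ ⊆ ω := fun h' => hno (Or.inl h')
    have hno2 : ¬ A₂ ⊆ ω := fun h' => hno (Or.inr h')
    obtain ⟨i₁, hi₁A, hi₁ω⟩ := Finset.not_subset.mp hno1
    obtain ⟨i₂, hi₂A, hi₂ω⟩ := Finset.not_subset.mp hno2
    obtain ⟨t, ht1, htL, rfl⟩ := (hA₁ i₁).mp hi₁A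
    obtain ⟨r, hr1, hrL, rfl⟩ := (hA₂ i₂).mp hi₂A
    -- the closed set of vertices before the first missing edge on each arc
    have hsub : openCluster (ends '' (↑ω : Set ι)) u ⊆ {x | (∃ j, j < t ∧ x = w₁ j) ∨ (∃ j, j < r ∧ x = w₂ j)} := by
      refine openCluster_subset_of_closed ends ω u (S := {x | (∃ j, j < t ∧ x = w₁ j) ∨ (∃ j, j < r ∧ x = w₂ j)})
        (Or.inl ⟨0, by omega, hw₁0.symm⟩) ?_
      intro i hi a c he ha
      -- normalise the end `a`: it is `w₁ j` (j < t) or `w₂ j` (j < r)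
      rcases Finset.mem_union.mp (hω hi) with hiA | hiA
      · obtain ⟨t', ht'1, ht'L, rfl⟩ := (hA₁ i).mp hiA
        have he' := harc₁ t' ht'1 ht'L
        rw [he'] at he
        have ha' : a = w₁ (t' - 1) ∨ a = w₁ t' := by
          have : a ∈ s(w₁ (t' - 1), w₁ t') := by rw [he]; exact Sym2.mem_mk_left a c
          exact Sym2.mem_iff.mp this
        have hc' : c = w₁ (t' - 1) ∨ c = w₁ t' := by
          have : c ∈ s(w₁ (t' - 1), w₁ t') := by rw [he]; exact Sym2.mem_mk_right a c
          exact Sym2.mem_iff.mp this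
        -- the index of a on arc 1 is < t
        have hidx : ∃ j, j < t ∧ (j = t' - 1 ∨ j = t') := by
          rcases ha with ⟨j, hj, hja⟩ | ⟨j, hj, hja⟩
          · rcases ha' with ha' | ha'
            · exact ⟨j, hj, Or.inl (hwinj₁ j (t' - 1) (by omega) (by omega) (hja.symm.trans ha'))⟩
            · exact ⟨j, hj, Or.inr (hwinj₁ j t' (by omega) ht'L (hja.symm.trans ha'))⟩
          · -- a = w₂ j is also on arc 1: a ∈ {u, b}
            rcases ha' with ha' | ha'
            · rcases hcross (t' - 1) j (by omega) (by omega) (ha'.symm.trans hja) with ⟨h0, _⟩ | ⟨hL', hj'⟩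
              · exact ⟨t' - 1, by omega, Or.inl rfl⟩
              · omega
            · rcases hcross t' j ht'L (by omega) (ha'.symm.trans hja) with ⟨h0, _⟩ | ⟨hL', hj'⟩
              · omega
              · omega
        obtain ⟨j, hjt, hj⟩ := hidx
        have hne : t' ≠ t := fun h => hi₁ω (h ▸ hi)
        have ht't : t' < t := by rcases hj with rfl | rfl <;> omega
        left
        rcases hc' with hc' | hc'
        · exact ⟨t' - 1, by omega, hc'⟩
        · exact ⟨t', ht't, hc'⟩
      · obtain ⟨r', hr'1, hr'L, rfl⟩ := (hA₂ i).mp hiA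
        have he' := harc₂ r' hr'1 hr'L
        rw [he'] at he
        have ha' : a = w₂ (r' - 1) ∨ a = w₂ r' := by
          have : a ∈ s(w₂ (r' - 1), w₂ r') := by rw [he]; exact Sym2.mem_mk_left a c
          exact Sym2.mem_iff.mp this
        have hc' : c = w₂ (r' - 1) ∨ c = w₂ r' := by
          have : c ∈ s(w₂ (r' - 1), w₂ r') := by rw [he]; exact Sym2.mem_mk_right a c
          exact Sym2.mem_iff.mp this
        have hidx : ∃ j, j < r ∧ (j = r' - 1 ∨ j = r') := by
          rcases ha with ⟨j, hj, hja⟩ | ⟨j, hj, hja⟩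
          · rcases ha' with ha' | ha'
            · rcases hcross j (r' - 1) (by omega) (by omega) (hja.symm.trans ha') with ⟨_, h0⟩ | ⟨hj', hL'⟩
              · exact ⟨r' - 1, by omega, Or.inl rfl⟩
              · omega
            · rcases hcross j r' (by omega) hr'L (hja.symm.trans ha') with ⟨_, h0⟩ | ⟨hj', hL'⟩
              · omega
              · omega
          · rcases ha' with ha' | ha'
            · exact ⟨j, hj, Or.inl (hwinj₂ j (r' - 1) (by omega) (by omega) (hja.symm.trans ha'))⟩
            · exact ⟨j, hj, Or.inr (hwinj₂ j r' (by omega) hr'L (hja.symm.trans ha'))⟩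
        obtain ⟨j, hjr, hj⟩ := hidx
        have hne : r' ≠ r := fun h => hi₂ω (h ▸ hi)
        have hr'r : r' < r := by rcases hj with rfl | rfl <;> omega
        right
        rcases hc' with hc' | hc'
        · exact ⟨r' - 1, by omega, hc'⟩
        · exact ⟨r', hr'r, hc'⟩
    rcases hsub hb with ⟨j, hj, hjb⟩ | ⟨j, hj, hjb⟩
    · have := hwinj₁ L₁ j (le_refl _) (by omega) (hw₁L.trans hjb); omega
    · have := hwinj₂ L₂ j (le_refl _) (by omega) (hw₂L.trans hjb); omega
  · rintro (h1 | h2)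
    · rw [← hw₁L, ← hw₁0]
      exact arc_reach_fwd ends L₁ w₁ e₁ harc₁ ω L₁ (le_refl _) fun t' ht1 ht2 => h1 ((hA₁ _).mpr ⟨t', ht1, ht2, rfl⟩)
    · rw [← hw₂L, ← hw₂0]
      exact arc_reach_fwd ends L₂ w₂ e₂ harc₂ ω L₂ (le_refl _) fun t' ht1 ht2 => h2 ((hA₂ _).mpr ⟨t', ht1, ht2, rfl⟩)

open Classical in
/-- **THEOREM IET-CYCLE.**  Let the cycle through `u` and `b` be given by two arcs: vertex sequences `w₁ 0 = w₂ 0 = u`, `w₁ L₁ = w₂ L₂ = b`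
(`L₁, L₂ ≥ 1`), injective along each arc and meeting only at the ends, edges `e₁ t`, `e₂ t` with `ends (eₖ t) = s(wₖ (t−1), wₖ t)`, distinct along
each arc, edge sets `A₁ = {e₁ 1..e₁ L₁}`, `A₂ = {e₂ 1..e₂ L₂}` disjoint.  Then for EVERY up-closed event `𝒱` on the colourings of `E = A₁ ∪ A₂` and all
monotone `h, k`, monotone levels `0 ≤ hᵃ, hᵇ ≤ h`, `0 ≤ kᵃ, kᵇ ≤ k`:
`0 ≤ Σ_{ω ⊆ E : 𝒱 ω, b ∈ C_u ω ∖ C_u(E∖ω)} h(C_u ω) k(C_u ω) + Σ_{ω ⊆ E : 𝒱 ω, b ∈ C_u(E∖ω) ∖ C_u ω} (hᵃ(C_u ω) − hᵇ(C_u(E∖ω)))(kᵃ(C_u ω) − kᵇ(C_u(E∖ω)))`.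
[cite: KozmaNitzan2024, Questions 8–9 (§5.5 p. 36) (context)] -/
theorem iet_cycle (ends : ι → Sym2 V) (L₁ L₂ : ℕ) (hL₁ : 1 ≤ L₁) (hL₂ : 1 ≤ L₂) (w₁ w₂ : ℕ → V) (e₁ e₂ : ℕ → ι) (u b : V)
    (hw₁0 : w₁ 0 = u) (hw₁L : w₁ L₁ = b) (hw₂0 : w₂ 0 = u) (hw₂L : w₂ L₂ = b)
    (harc₁ : ∀ t, 1 ≤ t → t ≤ L₁ → ends (e₁ t) = s(w₁ (t - 1), w₁ t))
    (harc₂ : ∀ t, 1 ≤ t → t ≤ L₂ → ends (e₂ t) = s(w₂ (t - 1), w₂ t))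
    (hwinj₁ : ∀ i j, i ≤ L₁ → j ≤ L₁ → w₁ i = w₁ j → i = j)
    (hwinj₂ : ∀ i j, i ≤ L₂ → j ≤ L₂ → w₂ i = w₂ j → i = j)
    (heinj₁ : ∀ s t, 1 ≤ s → s ≤ L₁ → 1 ≤ t → t ≤ L₁ → e₁ s = e₁ t → s = t)
    (heinj₂ : ∀ s t, 1 ≤ s → s ≤ L₂ → 1 ≤ t → t ≤ L₂ → e₂ s = e₂ t → s = t)
    (hcross : ∀ i j, i ≤ L₁ → j ≤ L₂ → w₁ i = w₂ j → (i = 0 ∧ j = 0) ∨ (i = L₁ ∧ j = L₂))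
    (A₁ A₂ : Finset ι) (hA₁ : ∀ i, i ∈ A₁ ↔ ∃ t, 1 ≤ t ∧ t ≤ L₁ ∧ e₁ t = i) (hA₂ : ∀ i, i ∈ A₂ ↔ ∃ t, 1 ≤ t ∧ t ≤ L₂ ∧ e₂ t = i)
    (hdisj : Disjoint A₁ A₂)
    (𝒱 : Finset ι → Prop) (hV : ∀ ⦃s t : Finset ι⦄, s ⊆ t → 𝒱 s → 𝒱 t)
    (h k ha hb ka kb : Set V → ℝ)
    (hh : Monotone h) (hk : Monotone k) (mha : Monotone ha) (mhb : Monotone hb) (mka : Monotone ka) (mkb : Monotone kb)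
    (ha0 : ∀ S, 0 ≤ ha S) (hah : ∀ S, ha S ≤ h S) (hb0 : ∀ S, 0 ≤ hb S) (hbh : ∀ S, hb S ≤ h S)
    (ka0 : ∀ S, 0 ≤ ka S) (kak : ∀ S, ka S ≤ k S) (kb0 : ∀ S, 0 ≤ kb S) (kbk : ∀ S, kb S ≤ k S) :
    0 ≤ (∑ ω ∈ (A₁ ∪ A₂).powerset, if 𝒱 ω ∧ b ∈ openCluster (ends '' (↑ω : Set ι)) u ∧ b ∉ openCluster (ends '' (↑((A₁ ∪ A₂) \ ω) : Set ι)) u then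
        h (openCluster (ends '' (↑ω : Set ι)) u) * k (openCluster (ends '' (↑ω : Set ι)) u) else 0)
      + ∑ ω ∈ (A₁ ∪ A₂).powerset, if 𝒱 ω ∧ b ∈ openCluster (ends '' (↑((A₁ ∪ A₂) \ ω) : Set ι)) u ∧ b ∉ openCluster (ends '' (↑ω : Set ι)) u then
        (ha (openCluster (ends '' (↑ω : Set ι)) u) - hb (openCluster (ends '' (↑((A₁ ∪ A₂) \ ω) : Set ι)) u)) *
          (ka (openCluster (ends '' (↑ω : Set ι)) u) - kb (openCluster (ends '' (↑((A₁ ∪ A₂) \ ω) : Set ι)) u)) else 0 := by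
  -- the suffix chains of the two arcs
  set T₁ : ℕ → Finset ι := fun m => A₁.filter (fun i => ∃ t, 1 ≤ t ∧ t ≤ L₁ ∧ L₁ < t + m ∧ e₁ t = i) with hT₁
  set T₂ : ℕ → Finset ι := fun m => A₂.filter (fun i => ∃ t, 1 ≤ t ∧ t ≤ L₂ ∧ L₂ < t + m ∧ e₂ t = i) with hT₂
  -- arc 1 avoids the interior of arc 2 and vice versa
  have hint₁₂ : ∀ f ∈ A₁, ∀ x, x ∈ ends f → ∀ j, 1 ≤ j → j < L₂ → x ≠ w₂ j := by
    intro f hf x hx j hj1 hjL hxj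
    obtain ⟨t, ht1, htL, rfl⟩ := (hA₁ f).mp hf
    rw [harc₁ t ht1 htL, Sym2.mem_iff] at hx
    rcases hx with rfl | rfl
    · rcases hcross (t - 1) j (by omega) (by omega) hxj with ⟨_, h0⟩ | ⟨_, hL⟩ <;> omega
    · rcases hcross t j htL (by omega) hxj with ⟨_, h0⟩ | ⟨_, hL⟩ <;> omega
  have hint₂₁ : ∀ f ∈ A₂, ∀ x, x ∈ ends f → ∀ j, 1 ≤ j → j < L₁ → x ≠ w₁ j := by
    intro f hf x hx j hj1 hjL hxj
    obtain ⟨t, ht1, htL, rfl⟩ := (hA₂ f).mp hf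
    rw [harc₂ t ht1 htL, Sym2.mem_iff] at hx
    rcases hx with rfl | rfl
    · rcases hcross j (t - 1) (by omega) (by omega) hxj.symm with ⟨h0, _⟩ | ⟨hL, _⟩ <;> omega
    · rcases hcross j t (by omega) htL hxj.symm with ⟨h0, _⟩ | ⟨hL, _⟩ <;> omega
  -- b is reached along each arc
  have hbA₁ : b ∈ openCluster (ends '' (↑A₁ : Set ι)) u := by
    rw [← hw₁L, ← hw₁0]
    exact arc_reach_fwd ends L₁ w₁ e₁ harc₁ A₁ L₁ (le_refl _) fun t' h1 h2 => (hA₁ _).mpr ⟨t', h1, h2, rfl⟩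
  have hbA₂ : b ∈ openCluster (ends '' (↑A₂ : Set ι)) u := by
    rw [← hw₂L, ← hw₂0]
    exact arc_reach_fwd ends L₂ w₂ e₂ harc₂ A₂ L₂ (le_refl _) fun t' h1 h2 => (hA₂ _).mpr ⟨t', h1, h2, rfl⟩
  -- elementary chain facts
  have chain0 : ∀ (A : Finset ι) (L : ℕ) (e : ℕ → ι), A.filter (fun i => ∃ t, 1 ≤ t ∧ t ≤ L ∧ L < t + 0 ∧ e t = i) = ∅ := by
    intro A L e
    rw [Finset.eq_empty_iff_forall_notMem]
    intro i hi
    obtain ⟨t, _, htL, htm, _⟩ := (Finset.mem_filter.mp hi).2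
    omega
  have chainMono : ∀ (A : Finset ι) (L : ℕ) (e : ℕ → ι) (m m' : ℕ), m ≤ m' →
      A.filter (fun i => ∃ t, 1 ≤ t ∧ t ≤ L ∧ L < t + m ∧ e t = i) ⊆ A.filter (fun i => ∃ t, 1 ≤ t ∧ t ≤ L ∧ L < t + m' ∧ e t = i) := by
    intro A L e m m' hmm' i hi
    obtain ⟨hiA, t, ht1, htL, htm, hte⟩ := Finset.mem_filter.mp hi
    exact Finset.mem_filter.mpr ⟨hiA, t, ht1, htL, by omega, hte⟩
  have chain1 : ∀ (A : Finset ι) (L : ℕ) (e : ℕ → ι), 1 ≤ L → (∀ i, i ∈ A ↔ ∃ t, 1 ≤ t ∧ t ≤ L ∧ e t = i) →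
      (A.filter (fun i => ∃ t, 1 ≤ t ∧ t ≤ L ∧ L < t + 1 ∧ e t = i)).Nonempty := by
    intro A L e hL hA
    exact ⟨e L, Finset.mem_filter.mpr ⟨(hA _).mpr ⟨L, hL, le_refl L, rfl⟩, L, hL, le_refl L, by omega, rfl⟩⟩
  -- set identities for the blue side
  have hsd₂ : ∀ η : Finset ι, η ⊆ A₂ → (A₁ ∪ A₂) \ η = A₁ ∪ (A₂ \ η) := by
    intro η hη; ext i
    simp only [Finset.mem_sdiff, Finset.mem_union]
    constructor
    · rintro ⟨h1 | h2, hn⟩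
      · exact Or.inl h1
      · exact Or.inr ⟨h2, hn⟩
    · rintro (h1 | ⟨h2, hn⟩)
      · exact ⟨Or.inl h1, fun hin => Finset.disjoint_left.mp hdisj h1 (hη hin)⟩
      · exact ⟨Or.inr h2, hn⟩
  have hsd₁ : ∀ η : Finset ι, η ⊆ A₁ → (A₁ ∪ A₂) \ η = A₂ ∪ (A₁ \ η) := by
    intro η hη; ext i
    simp only [Finset.mem_sdiff, Finset.mem_union]
    constructor
    · rintro ⟨h1 | h2, hn⟩
      · exact Or.inr ⟨h1, hn⟩
      · exact Or.inl h2
    · rintro (h2 | ⟨h1, hn⟩)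
      · exact ⟨Or.inr h2, fun hin => Finset.disjoint_left.mp hdisj (hη hin) h2⟩
      · exact ⟨Or.inl h1, hn⟩
  refine iet_twoArc_of_clusterFacts ends A₁ A₂ hdisj ⟨e₁ 1, (hA₁ _).mpr ⟨1, le_refl 1, hL₁, rfl⟩⟩ ⟨e₂ 1, (hA₂ _).mpr ⟨1, le_refl 1, hL₂, rfl⟩⟩ u b
    (fun ω hω => cycle_twoRoutes ends L₁ L₂ w₁ w₂ e₁ e₂ u b hw₁0 hw₁L hw₂0 hw₂L harc₁ harc₂ hwinj₁ hwinj₂ hcross A₁ A₂ hA₁ hA₂ ω hω)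
    L₂ T₂ (chain0 A₂ L₂ e₂) (chainMono A₂ L₂ e₂) (fun m => Finset.filter_subset _ _) (chain1 A₂ L₂ e₂ hL₂ hA₂)
    L₁ T₁ (chain0 A₁ L₁ e₁) (chainMono A₁ L₁ e₁) (fun m => Finset.filter_subset _ _) (chain1 A₁ L₁ e₁ hL₁ hA₁)
    ?_ ?_ ?_ ?_ ?_ ?_ 𝒱 hV h k ha hb ka kb hh hk mha mhb mka mkb ha0 hah hb0 hbh ka0 kak kb0 kbk
  · -- (G⋆) for arc 2 against A₁
    exact arc_Gstar ends L₂ hL₂ w₂ e₂ u b hw₂0 hw₂L harc₂ heinj₂ A₂ hA₂ A₁ hbA₁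
  · -- (G⋆) for arc 1 against A₂
    exact arc_Gstar ends L₁ hL₁ w₁ e₁ u b hw₁0 hw₁L harc₁ heinj₁ A₁ hA₁ A₂ hbA₂
  · -- (YJ) for arc 2
    intro η hη _ hx
    rw [hsd₂ η hη]
    exact arc_YJ ends L₂ hL₂ w₂ e₂ u b hw₂0 hw₂L harc₂ hwinj₂ heinj₂ A₂ hA₂ A₁ hint₁₂ hbA₁ η hη hx
  · -- (YJ) for arc 1
    intro η hη _ hx
    rw [hsd₁ η hη]
    exact arc_YJ ends L₁ hL₁ w₁ e₁ u b hw₁0 hw₁L harc₁ hwinj₁ heinj₁ A₁ hA₁ A₂ hint₂₁ hbA₂ η hη hx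
  · -- (Yσ) for arc 2
    intro η hη _ hx
    rw [hsd₂ η hη]
    exact arc_Ysigma ends L₂ hL₂ w₂ e₂ u b hw₂0 hw₂L harc₂ hwinj₂ heinj₂ A₂ hA₂ A₁ hint₁₂ hbA₁ η hη hx
  · -- (Yσ) for arc 1
    intro η hη _ hx
    rw [hsd₁ η hη]
    exact arc_Ysigma ends L₁ hL₁ w₁ e₁ u b hw₁0 hw₁L harc₁ hwinj₁ heinj₁ A₁ hA₁ A₂ hint₂₁ hbA₂ η hη hx

end Coefficientwise

end Summit.CriticalPhenomena.PercolationContinuityZ3.Theorems
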